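import Summits.CriticalPhenomena.PercolationContinuityZ3.Theorems.PercNearOneGluingNoHeavyConstsMDLXJoint
import HarnessLib

/-!
# MDL(X)′ holds at the marker functional `F = 1{s ↔ y}` (PAPER-2 track (ii): constants of the CSH family)

builds on p205010 (kernel theorem, internal audit signed; external expert review pending).  Support file (`--supports
stmt-CriticalPhenomena-4575`), seat `prim-consts-2` (gen 9); memo `run/shared/lean/prim/consts/FROM-prim-consts-2-g9-MDLXJOINT.md` §6.
No definitions, no named facts, no sorries.

`Consts.MDLXJoint` (OPEN) says that for every monotone functional `F` of the edge cluster `C_s`,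
`μ(𝒜∩D∩W)·[μ(D)∫_{D∩Y}F − (∫_D F)μ(D∩Y)] ≤ μ(𝒜∩D)·[μ(D)∫_{D∩Z}F − (∫_D F)μ(D∩Z)]`
(`D = {s ↮ X}`, `𝒜 = {y ↮ {s}∪X}`, `W = {y ↔ z}`, `Z = {s ↔ z}`, `Y = {s ↔ y}`; the jointly-conditioned constant
`p' = μ(𝒜∩D∩W)/μ(𝒜∩D)`).  This file PROVES it for the marker functional itself, `F = 1{s ↔ y}` (`= connIndicatorFn s y` read on `C_s`):

* `Consts.mdlxJoint_connIndicator` — **THEOREM.** For every finite weighted graph, all `s, y, z`, `X`: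
  `μ(𝒜∩D∩W) · μ(D∩Y) · μ(D ∖ Y) ≤ μ(𝒜∩D) · [μ(D)μ(D∩Y∩Z) − μ(D∩Y)μ(D∩Z)]`,
  i.e. `Cov(1{s↔y}, 1{s↔z} | s ↮ X) ≥ p' · P(s↔y | s↮X) P(s↮y | s↮X)`, equivalently
  `P(s ↔ z | s ↔ y, s ↮ X) ≥ P(s ↔ z | s ↮ X) + p'·P(s ↮ y | s ↮ X)`.
  PROOF (memo §6; exact identity checked on 580 random instances): with `E₁ = {s ↮ X, y ↮ X}`, `T = 𝒜∩D = E₁ ∩ {s↮y}`,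
  `G = D ∩ {y ↔ X}` one has `D = E₁ ⊔ G`, `D∩Y ⊆ E₁`, `D ∖ Y = T ⊔ G` and the IDENTITY
  `RHS − LHS = μ(D∖Y)·Q + μ(D∩Y)·R`, where
  `Q = μ(E₁)μ(E₁∩Y∩Z) − μ(E₁∩Y)·[μ(E₁∩Z) + μ(T∩W)] ≥ 0` is van den Berg–Häggström–Kahn's Theorem 1.3 WITH SETS for the source set
  `{s, y}` repelled from `X` (the events `{s ↔ y}` and `{z ∈ C_s ∪ C_y}` are increasing in `C_{{s,y}}`; on `{s↔y}` the second is `{s↔z}`,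
  off it it splits as `{s↔z} ⊔ {y↔z}`), and `R = μ(G)μ(T∩Z) − μ(T)μ(G∩Z) ≥ 0` is Theorem 1.4 with sets for `{s}` repelled from `X ∪ {y}`
  (`{s ↔ z}` and `{y ↔ X}` are negatively correlated given `s ↮ X∪{y}`).
* `Consts.mdlxJoint_at_connIndicator` — the same in the literal shape of `Consts.MDLXJoint` (integrals of `connIndicatorFn s y`).
Context: the transfer constant of the tree's MDL(X) is `p = P(y↔z | y↮{s}∪X) ≤ p'` (`Consts.jointObserverConst_ge`); the conjecture MDL(X)′
survived an exact adversarial census and is three-copy positive on all graphs `n ≤ 6` (memo §5, `Consts.MDLXJointBernstein`); the marker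
functional is the first functional class (beyond `X = ∅` and the single-pair functional `1{s(s,y) ∈ C_s}`, `Consts.jointObsConst_le_singleEdgeConst`)
for which `p'` is proved admissible.
[cite: VandenbergHaggstromKahn2005, Thm. 1.3 (p. 6), Thm. 1.4 (p. 7) with Remark 1 after Thm. 1.2 (p. 5); KozmaNitzan2024 §2.2 p. 5]
-/

noncomputable section

namespace Summit.CriticalPhenomena.PercolationContinuityZ3.Theorems

open MeasureTheory Set Literature.Probability.LatticeModels Literature.Probability.Percolation
open scoped Classical

namespace Consts

variable {V : Type*} [Fintype V]

/-- **MDL(X)′ at the marker functional** (measure form).  `D = {s↮X}`, `𝒜 = {y ↮ {s}∪X}`, `W = {y↔z}`, `Z = {s↔z}`, `Y = {s↔y}`: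
`μ(𝒜∩D∩W)·μ(D∩Y)·μ(D∩Yᶜ) ≤ μ(𝒜∩D)·[μ(D)μ(D∩Y∩Z) − μ(D∩Y)μ(D∩Z)]`.
Proof: `RHS − LHS = μ(D∩Yᶜ)·Q + μ(D∩Y)·R` with `Q ≥ 0` (BHK Thm 1.3 with sets, source `{s,y}`, repelled `X`) and `R ≥ 0`
(BHK Thm 1.4 with sets, `{s}` vs `X ∪ {y}`). [cite: VandenbergHaggstromKahn2005, Thm. 1.3 (p. 6), Thm. 1.4 (p. 7), Remark 1 (p. 5)] -/
theorem mdlxJoint_connIndicator (w : Sym2 V → unitInterval) (s y z : V) (X : Set V) :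
    (prodBernoulli w).real ({ω : BondConfig V | ∀ x ∈ insert s X, ¬ (openGraph ω).Reachable y x} ∩
        {ω | ∀ x ∈ X, ¬ (openGraph ω).Reachable s x} ∩ openConn y z) *
      (prodBernoulli w).real ({ω : BondConfig V | ∀ x ∈ X, ¬ (openGraph ω).Reachable s x} ∩ openConn s y) *
      (prodBernoulli w).real ({ω : BondConfig V | ∀ x ∈ X, ¬ (openGraph ω).Reachable s x} ∩ (openConn s y)ᶜ) ≤
    (prodBernoulli w).real ({ω : BondConfig V | ∀ x ∈ insert s X, ¬ (openGraph ω).Reachable y x} ∩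
        {ω | ∀ x ∈ X, ¬ (openGraph ω).Reachable s x}) *
      ((prodBernoulli w).real {ω : BondConfig V | ∀ x ∈ X, ¬ (openGraph ω).Reachable s x} *
          (prodBernoulli w).real ({ω : BondConfig V | ∀ x ∈ X, ¬ (openGraph ω).Reachable s x} ∩ openConn s y ∩ openConn s z) -
        (prodBernoulli w).real ({ω : BondConfig V | ∀ x ∈ X, ¬ (openGraph ω).Reachable s x} ∩ openConn s y) *
          (prodBernoulli w).real ({ω : BondConfig V | ∀ x ∈ X, ¬ (openGraph ω).Reachable s x} ∩ openConn s z)) := by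
  classical
  set μ := prodBernoulli w with hμ
  have hmeas : ∀ S : Set (BondConfig V), MeasurableSet S := fun _ => MeasurableSet.of_discrete
  set D : Set (BondConfig V) := {ω | ∀ x ∈ X, ¬ (openGraph ω).Reachable s x} with hD
  set A : Set (BondConfig V) := {ω | ∀ x ∈ insert s X, ¬ (openGraph ω).Reachable y x} with hA
  set Yv : Set (BondConfig V) := openConn s y with hYv
  set Zv : Set (BondConfig V) := openConn s z with hZv
  set Wv : Set (BondConfig V) := openConn y z with hWv
  -- auxiliary events
  set E₁ : Set (BondConfig V) := {ω | ∀ a ∈ ({s, y} : Set V), ∀ x ∈ X, ¬ (openGraph ω).Reachable a x} with hE₁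
  set E₂ : Set (BondConfig V) := {ω | ∀ a ∈ ({s} : Set V), ∀ x ∈ insert y X, ¬ (openGraph ω).Reachable a x} with hE₂
  set Gy : Set (BondConfig V) := {ω | ∃ x ∈ X, (openGraph ω).Reachable y x} with hGy
  set T : Set (BondConfig V) := A ∩ D with hT
  set G : Set (BondConfig V) := D ∩ Gy with hG
  -- elementary membership facts
  have mD : ∀ ω, ω ∈ D ↔ ∀ x ∈ X, ¬ (openGraph ω).Reachable s x := fun ω => Iff.rfl
  have mA : ∀ ω, ω ∈ A ↔ ¬ (openGraph ω).Reachable y s ∧ ∀ x ∈ X, ¬ (openGraph ω).Reachable y x := by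
    intro ω; simp only [hA, mem_setOf_eq, mem_insert_iff, forall_eq_or_imp]
  have mE₁ : ∀ ω, ω ∈ E₁ ↔ (∀ x ∈ X, ¬ (openGraph ω).Reachable s x) ∧ ∀ x ∈ X, ¬ (openGraph ω).Reachable y x := by
    intro ω; simp only [hE₁, mem_setOf_eq, mem_insert_iff, mem_singleton_iff, forall_eq_or_imp, forall_eq]
  have mE₂ : ∀ ω, ω ∈ E₂ ↔ ¬ (openGraph ω).Reachable s y ∧ ∀ x ∈ X, ¬ (openGraph ω).Reachable s x := by
    intro ω; simp only [hE₂, mem_setOf_eq, mem_singleton_iff, forall_eq, mem_insert_iff, forall_eq_or_imp]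
  have mY : ∀ ω, ω ∈ Yv ↔ (openGraph ω).Reachable s y := fun ω => Iff.rfl
  have mZ : ∀ ω, ω ∈ Zv ↔ (openGraph ω).Reachable s z := fun ω => Iff.rfl
  have mW : ∀ ω, ω ∈ Wv ↔ (openGraph ω).Reachable y z := fun ω => Iff.rfl
  have mGy : ∀ ω, ω ∈ Gy ↔ ∃ x ∈ X, (openGraph ω).Reachable y x := fun ω => Iff.rfl
  -- set identities
  have sDE : D = E₁ ∪ G := by
    ext ω; simp only [mem_union, hG, mem_inter_iff, mE₁, mD, mGy]
    constructor
    · intro h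
      by_cases hyx : ∃ x ∈ X, (openGraph ω).Reachable y x
      · exact Or.inr ⟨h, hyx⟩
      · simp only [not_exists, not_and] at hyx; exact Or.inl ⟨h, hyx⟩
    · rintro (⟨h, -⟩ | ⟨h, -⟩) <;> exact h
  have dDE : Disjoint E₁ G := by
    rw [Set.disjoint_left]; intro ω h1 h2
    obtain ⟨x, hx, hr⟩ := (mem_inter_iff _ _ _).1 h2 |>.2
    exact ((mE₁ ω).1 h1).2 x hx hr
  have sDY : D ∩ Yv = E₁ ∩ Yv := by
    ext ω; simp only [mem_inter_iff, mE₁, mD, mY]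
    constructor
    · rintro ⟨h, hsy⟩; exact ⟨⟨h, fun x hx hr => h x hx (hsy.trans hr)⟩, hsy⟩
    · rintro ⟨⟨h, -⟩, hsy⟩; exact ⟨h, hsy⟩
  have sDYZ : D ∩ Yv ∩ Zv = E₁ ∩ Yv ∩ Zv := by rw [sDY]
  have sDZ : D ∩ Zv = E₁ ∩ Zv ∪ G ∩ Zv := by rw [sDE, union_inter_distrib_right]
  have dDZ : Disjoint (E₁ ∩ Zv) (G ∩ Zv) := dDE.mono inter_subset_left inter_subset_left
  have sT : T = E₁ ∩ Yvᶜ := by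
    ext ω; simp only [hT, mem_inter_iff, mA, mD, mE₁, mem_compl_iff, mY]
    constructor
    · rintro ⟨⟨hys, hyX⟩, hsX⟩; exact ⟨⟨hsX, hyX⟩, fun h => hys h.symm⟩
    · rintro ⟨⟨hsX, hyX⟩, hsy⟩; exact ⟨⟨fun h => hsy h.symm, hyX⟩, hsX⟩
  have sE₁ : E₁ = T ∪ E₁ ∩ Yv := by
    rw [sT, ← inter_union_distrib_left, compl_union_self, inter_univ]
  have dE₁ : Disjoint T (E₁ ∩ Yv) := by
    rw [sT]; exact Disjoint.mono inter_subset_right inter_subset_right disjoint_compl_left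
  have sE₁Z : E₁ ∩ Zv = T ∩ Zv ∪ E₁ ∩ Yv ∩ Zv := by
    conv_lhs => rw [sE₁]
    rw [union_inter_distrib_right]
  have dE₁Z : Disjoint (T ∩ Zv) (E₁ ∩ Yv ∩ Zv) := dE₁.mono inter_subset_left inter_subset_left
  have sDN : D ∩ Yvᶜ = T ∪ G := by
    ext ω; simp only [mem_inter_iff, mem_compl_iff, mem_union, sT, hG, mE₁, mD, mY, mGy]
    constructor
    · rintro ⟨hsX, hsy⟩
      by_cases hyx : ∃ x ∈ X, (openGraph ω).Reachable y x
      · exact Or.inr ⟨hsX, hyx⟩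
      · simp only [not_exists, not_and] at hyx; exact Or.inl ⟨⟨hsX, hyx⟩, hsy⟩
    · rintro (⟨⟨hsX, -⟩, hsy⟩ | ⟨hsX, ⟨x, hx, hr⟩⟩)
      · exact ⟨hsX, hsy⟩
      · exact ⟨hsX, fun hsy => hsX x hx (hsy.trans hr)⟩
  have dDN : Disjoint T G := by
    rw [sT]; exact dDE.mono inter_subset_left le_rfl
  -- (Q) BHK Theorem 1.3 with sets: source `{s, y}` repelled from `X`
  set F₁ : Set (Sym2 V) → ℝ := fun C => if (openGraph C).Reachable s y then 1 else 0 with hF₁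
  set G₁ : Set (Sym2 V) → ℝ := fun C => if (openGraph C).Reachable s z ∨ (openGraph C).Reachable y z then 1 else 0 with hG₁
  have hF₁m : Monotone F₁ := by
    intro C C' h; simp only [hF₁]
    by_cases hc : (openGraph C).Reachable s y
    · rw [if_pos hc, if_pos (hc.mono (openGraph_mono h))]
    · rw [if_neg hc]; split_ifs <;> norm_num
  have hG₁m : Monotone G₁ := by
    intro C C' h; simp only [hG₁]
    by_cases hc : (openGraph C).Reachable s z ∨ (openGraph C).Reachable y z
    · rw [if_pos hc, if_pos (hc.imp (fun hr => hr.mono (openGraph_mono h)) (fun hr => hr.mono (openGraph_mono h)))]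
    · rw [if_neg hc]; split_ifs <;> norm_num
  have hF₁ω : ∀ ω : BondConfig V, F₁ (⋃ a ∈ ({s, y} : Set V), openEdgeCluster ω a) = Yv.indicator 1 ω := by
    intro ω
    have e := (KNSep.reachable_iff_cluster ω ({s, y} : Set V) (mem_insert s {y}) y).symm
    simp only [hF₁, e]
    by_cases h : (openGraph ω).Reachable s y
    · rw [if_pos h, indicator_of_mem (show ω ∈ Yv from h), Pi.one_apply]
    · rw [if_neg h, indicator_of_notMem (show ω ∉ Yv from h)]
  have hG₁ω : ∀ ω : BondConfig V, G₁ (⋃ a ∈ ({s, y} : Set V), openEdgeCluster ω a) = (Zv ∪ Wv).indicator 1 ω := by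
    intro ω
    have e1 := (KNSep.reachable_iff_cluster ω ({s, y} : Set V) (mem_insert s {y}) z).symm
    have e2 := (KNSep.reachable_iff_cluster ω ({s, y} : Set V) (mem_insert_of_mem s (mem_singleton y)) z).symm
    simp only [hG₁, e1, e2]
    by_cases h : (openGraph ω).Reachable s z ∨ (openGraph ω).Reachable y z
    · rw [if_pos h, indicator_of_mem (show ω ∈ Zv ∪ Wv from h), Pi.one_apply]
    · rw [if_neg h, indicator_of_notMem (show ω ∉ Zv ∪ Wv from h)]
  have hQ0 := BHK2006_setClusterConditionalPositiveAssociation w ({s, y} : Set V) X F₁ G₁ hF₁m hG₁m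
  simp only [hF₁ω, hG₁ω] at hQ0
  change (∫ ω in E₁, Yv.indicator 1 ω ∂μ) * (∫ ω in E₁, (Zv ∪ Wv).indicator 1 ω ∂μ) ≤
    μ.real E₁ * ∫ ω in E₁, Yv.indicator 1 ω * (Zv ∪ Wv).indicator 1 ω ∂μ at hQ0
  rw [TripodExchange.setIntegral_indicator_one_eq, TripodExchange.setIntegral_indicator_one_eq,
    TripodExchange.setIntegral_indicator_mul_indicator_eq] at hQ0
  -- hQ0 : μ(E₁ ∩ Yv) * μ(E₁ ∩ (Zv ∪ Wv)) ≤ μ E₁ * μ(E₁ ∩ (Yv ∩ (Zv ∪ Wv)))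
  have sYZW : E₁ ∩ (Yv ∩ (Zv ∪ Wv)) = E₁ ∩ Yv ∩ Zv := by
    ext ω; simp only [mem_inter_iff, mem_union, mY, mZ, mW]
    constructor
    · rintro ⟨h1, hsy, hzw⟩
      exact ⟨⟨h1, hsy⟩, hzw.elim id fun hyz => hsy.trans hyz⟩
    · rintro ⟨⟨h1, hsy⟩, hsz⟩; exact ⟨h1, hsy, Or.inl hsz⟩
  have sZW : E₁ ∩ (Zv ∪ Wv) = E₁ ∩ Zv ∪ T ∩ Wv := by
    ext ω; simp only [mem_inter_iff, mem_union, sT, mem_compl_iff, mY, mZ, mW]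
    constructor
    · rintro ⟨h1, (hsz | hyz)⟩
      · exact Or.inl ⟨h1, hsz⟩
      · by_cases hsz : (openGraph ω).Reachable s z
        · exact Or.inl ⟨h1, hsz⟩
        · exact Or.inr ⟨⟨h1, fun hsy => hsz (hsy.trans hyz)⟩, hyz⟩
    · rintro (⟨h1, hsz⟩ | ⟨⟨h1, -⟩, hyz⟩)
      · exact ⟨h1, Or.inl hsz⟩
      · exact ⟨h1, Or.inr hyz⟩
  have dZW : Disjoint (E₁ ∩ Zv) (T ∩ Wv) := by
    rw [Set.disjoint_left]
    rintro ω ⟨-, hsz⟩ ⟨hT', hyz⟩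
    rw [sT] at hT'
    exact hT'.2 ((show (openGraph ω).Reachable s z from hsz).trans (show (openGraph ω).Reachable y z from hyz).symm)
  rw [sYZW, sZW, measureReal_union dZW (hmeas _)] at hQ0
  -- (R) BHK Theorem 1.4 with sets: `{s}` repelled from `X ∪ {y}`
  set G₂ : Set (Sym2 V) → ℝ := fun C => if ∃ x ∈ X, (openGraph C).Reachable y x then 1 else 0 with hG₂
  have hG₂m : Monotone G₂ := by
    refine TripodExchange.predIndicator_monotone ?_
    rintro C C' hCC' ⟨x, hx, hr⟩
    exact ⟨x, hx, hr.mono (openGraph_mono hCC')⟩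
  have hF₂ω : ∀ ω : BondConfig V, connIndicatorFn s z (⋃ a ∈ ({s} : Set V), openEdgeCluster ω a) = Zv.indicator 1 ω := by
    intro ω
    have : (⋃ a ∈ ({s} : Set V), openEdgeCluster ω a) = openEdgeCluster ω s := by ext e; simp
    rw [this, connIndicatorFn_openEdgeCluster]
  have hG₂ω : ∀ ω : BondConfig V, G₂ (⋃ t ∈ insert y X, openEdgeCluster ω t) = Gy.indicator 1 ω := by
    intro ω
    have hiff : (∃ x ∈ X, (openGraph (⋃ t ∈ insert y X, openEdgeCluster ω t)).Reachable y x) ↔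
        ∃ x ∈ X, (openGraph ω).Reachable y x := by
      constructor
      · rintro ⟨x, hx, hr⟩
        exact ⟨x, hx, (KNSep.reachable_iff_cluster ω (insert y X) (mem_insert y X) x).2 hr⟩
      · rintro ⟨x, hx, hr⟩
        exact ⟨x, hx, (KNSep.reachable_iff_cluster ω (insert y X) (mem_insert y X) x).1 hr⟩
    simp only [hG₂, hiff]
    exact TwoSetConditionalAssociation.predIndicator_eq_indicator (fun ω' => ∃ x ∈ X, (openGraph ω').Reachable y x) ω
  have hR0 := BHK2006_twoSetConditionalAssociation.negCorrelation w ({s} : Set V) (insert y X) (connIndicatorFn s z) G₂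
    (monotone_connIndicatorFn s z) hG₂m
  simp only [hF₂ω, hG₂ω] at hR0
  change μ.real E₂ * (∫ ω in E₂, Zv.indicator 1 ω * Gy.indicator 1 ω ∂μ) ≤
    (∫ ω in E₂, Zv.indicator 1 ω ∂μ) * ∫ ω in E₂, Gy.indicator 1 ω ∂μ at hR0
  rw [TripodExchange.setIntegral_indicator_one_eq, TripodExchange.setIntegral_indicator_one_eq,
    TripodExchange.setIntegral_indicator_mul_indicator_eq] at hR0
  -- hR0 : μ E₂ * μ(E₂ ∩ (Zv ∩ Gy)) ≤ μ(E₂ ∩ Zv) * μ(E₂ ∩ Gy)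
  have sE₂ : E₂ = T ∪ G := by
    rw [← sDN]
    ext ω; simp only [mE₂, mem_inter_iff, mD, mem_compl_iff, mY]; tauto
  have sE₂G : E₂ ∩ Gy = G := by
    ext ω; simp only [mem_inter_iff, mE₂, hG, mD, mGy]
    constructor
    · rintro ⟨⟨-, hsX⟩, hyx⟩; exact ⟨hsX, hyx⟩
    · rintro ⟨hsX, ⟨x, hx, hr⟩⟩; exact ⟨⟨fun hsy => hsX x hx (hsy.trans hr), hsX⟩, ⟨x, hx, hr⟩⟩
  have sE₂ZG : E₂ ∩ (Zv ∩ Gy) = G ∩ Zv := by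
    rw [inter_comm Zv Gy, ← inter_assoc, sE₂G]
  have sE₂Z : E₂ ∩ Zv = T ∩ Zv ∪ G ∩ Zv := by rw [sE₂, union_inter_distrib_right]
  have dTGZ : Disjoint (T ∩ Zv) (G ∩ Zv) := dDN.mono inter_subset_left inter_subset_left
  rw [sE₂ZG, sE₂Z, sE₂G, sE₂, measureReal_union dDN (hmeas _), measureReal_union dTGZ (hmeas _)] at hR0
  -- rewrite the goal in terms of the pieces
  have eE₁ : μ.real E₁ = μ.real T + μ.real (E₁ ∩ Yv) := by
    rw [← measureReal_union dE₁ (hmeas _), ← sE₁]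
  have eE₁Z : μ.real (E₁ ∩ Zv) = μ.real (T ∩ Zv) + μ.real (E₁ ∩ Yv ∩ Zv) := by
    rw [← measureReal_union dE₁Z (hmeas _), ← sE₁Z]
  have eD : μ.real D = μ.real T + μ.real (E₁ ∩ Yv) + μ.real G := by
    rw [sDE, measureReal_union dDE (hmeas _), eE₁]
  have eDZ : μ.real (D ∩ Zv) = μ.real (T ∩ Zv) + μ.real (E₁ ∩ Yv ∩ Zv) + μ.real (G ∩ Zv) := by
    rw [sDZ, measureReal_union dDZ (hmeas _), eE₁Z]
  have eDN : μ.real (D ∩ Yvᶜ) = μ.real T + μ.real G := by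
    rw [sDN, measureReal_union dDN (hmeas _)]
  have eADW : μ.real (A ∩ D ∩ Wv) = μ.real (T ∩ Wv) := rfl
  have eAD : μ.real (A ∩ D) = μ.real T := rfl
  change μ.real (A ∩ D ∩ Wv) * μ.real (D ∩ Yv) * μ.real (D ∩ Yvᶜ) ≤
    μ.real (A ∩ D) * (μ.real D * μ.real (D ∩ Yv ∩ Zv) - μ.real (D ∩ Yv) * μ.real (D ∩ Zv))
  rw [eADW, eAD, sDY, eD, eDZ, eDN]
  rw [eE₁, eE₁Z] at hQ0
  -- nonnegativity of the pieces and the final combination `RHS − LHS = μ(D∖Y)·Q + μ(D∩Y)·R`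
  have h0 : ∀ S : Set (BondConfig V), 0 ≤ μ.real S := fun _ => measureReal_nonneg
  nlinarith [hQ0, hR0, h0 T, h0 G, h0 (E₁ ∩ Yv), h0 (T ∩ Zv), h0 (G ∩ Zv), h0 (E₁ ∩ Yv ∩ Zv), h0 (T ∩ Wv),
    mul_nonneg (add_nonneg (h0 T) (h0 G)) (sub_nonneg.2 hQ0), mul_nonneg (h0 (E₁ ∩ Yv)) (sub_nonneg.2 hR0)]


/-- **MDL(X)′ at the marker functional, in the shape of `Consts.MDLXJoint`**: the conjectured inequality with
`F = connIndicatorFn s y` (`F(C_s) = 1{s ↔ y}`), for every finite weighted graph and all `s, y, z, X`.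
[cite: VandenbergHaggstromKahn2005, Thm. 1.3 (p. 6), Thm. 1.4 (p. 7), Remark 1 (p. 5)] -/
theorem mdlxJoint_at_connIndicator (w : Sym2 V → unitInterval) (s y z : V) (X : Set V) :
    (prodBernoulli w).real ({ω : BondConfig V | ∀ x ∈ insert s X, ¬ (openGraph ω).Reachable y x} ∩
          {ω | ∀ x ∈ X, ¬ (openGraph ω).Reachable s x} ∩ openConn y z) *
        ((prodBernoulli w).real {ω : BondConfig V | ∀ x ∈ X, ¬ (openGraph ω).Reachable s x} *
            (∫ ω in {ω : BondConfig V | ∀ x ∈ X, ¬ (openGraph ω).Reachable s x} ∩ openConn s y,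
              connIndicatorFn s y (openEdgeCluster ω s) ∂(prodBernoulli w)) -
          (∫ ω in {ω : BondConfig V | ∀ x ∈ X, ¬ (openGraph ω).Reachable s x},
              connIndicatorFn s y (openEdgeCluster ω s) ∂(prodBernoulli w)) *
            (prodBernoulli w).real ({ω : BondConfig V | ∀ x ∈ X, ¬ (openGraph ω).Reachable s x} ∩ openConn s y)) ≤
      (prodBernoulli w).real ({ω : BondConfig V | ∀ x ∈ insert s X, ¬ (openGraph ω).Reachable y x} ∩
          {ω | ∀ x ∈ X, ¬ (openGraph ω).Reachable s x}) *
        ((prodBernoulli w).real {ω : BondConfig V | ∀ x ∈ X, ¬ (openGraph ω).Reachable s x} *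
            (∫ ω in {ω : BondConfig V | ∀ x ∈ X, ¬ (openGraph ω).Reachable s x} ∩ openConn s z,
              connIndicatorFn s y (openEdgeCluster ω s) ∂(prodBernoulli w)) -
          (∫ ω in {ω : BondConfig V | ∀ x ∈ X, ¬ (openGraph ω).Reachable s x},
              connIndicatorFn s y (openEdgeCluster ω s) ∂(prodBernoulli w)) *
            (prodBernoulli w).real ({ω : BondConfig V | ∀ x ∈ X, ¬ (openGraph ω).Reachable s x} ∩ openConn s z)) := by
  classical
  set μ := prodBernoulli w with hμ
  set D : Set (BondConfig V) := {ω | ∀ x ∈ X, ¬ (openGraph ω).Reachable s x} with hD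
  set A : Set (BondConfig V) := {ω | ∀ x ∈ insert s X, ¬ (openGraph ω).Reachable y x} with hA
  have hmeas : ∀ S : Set (BondConfig V), MeasurableSet S := fun _ => MeasurableSet.of_discrete
  simp_rw [connIndicatorFn_openEdgeCluster]
  rw [KNPreFKG.setIntegral_indicator_one_eq, KNPreFKG.setIntegral_indicator_one_eq,
    KNPreFKG.setIntegral_indicator_one_eq]
  have e1 : D ∩ openConn s y ∩ openConn s y = D ∩ openConn s y := by rw [inter_assoc, inter_self]
  have e2 : D ∩ openConn s z ∩ openConn s y = D ∩ openConn s y ∩ openConn s z := inter_right_comm D _ _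
  rw [e1, e2]
  have key := mdlxJoint_connIndicator w s y z X
  have hsplit : μ.real D = μ.real (D ∩ openConn s y) + μ.real (D ∩ (openConn s y)ᶜ) := by
    rw [← Set.sdiff_eq]
    exact (measureReal_inter_add_sdiff (μ := μ) (s := D) (hmeas (openConn s y))).symm
  change μ.real (A ∩ D ∩ openConn y z) * (μ.real D * μ.real (D ∩ openConn s y) -
      μ.real (D ∩ openConn s y) * μ.real (D ∩ openConn s y)) ≤
    μ.real (A ∩ D) * (μ.real D * μ.real (D ∩ openConn s y ∩ openConn s z) -
      μ.real (D ∩ openConn s y) * μ.real (D ∩ openConn s z))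
  have e3 : μ.real (A ∩ D ∩ openConn y z) * (μ.real D * μ.real (D ∩ openConn s y) -
      μ.real (D ∩ openConn s y) * μ.real (D ∩ openConn s y)) =
      μ.real (A ∩ D ∩ openConn y z) * μ.real (D ∩ openConn s y) * μ.real (D ∩ (openConn s y)ᶜ) := by
    rw [hsplit]; ring
  rw [e3]
  exact key

end Consts

end Summit.CriticalPhenomena.PercolationContinuityZ3.Theorems

end
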